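import Summits.ABC.IUTFork.Joshi.ATS1ConnectednessCohomology
import Summits.ABC.IUTFork.Joshi.InitialThetaDataJoshi
import HarnessLib

/-!
# [J-III] Remark 3.3.1 «every local holomorphoid of `X/L` at `v` has the field of definition `L_mod`» — TYPED as a
# claim over [J-I] Thm. 6.3.1's typed form, with the derivation Thm. 6.3.1 ⟹ Rmk. 3.3.1 in kernel (bridge file)

Record file of the abc-iut cell, block E «type Joshi's construction, test vs S» (rung LADDER-ABC:A2.E; seat
abc-iut-E-t63; registry row `J3:Rmk3.3.1` of `HOME/plan/E/JOSHI-DAG.tsv`, the one [J-III] row yielded by slot T-06).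
TAKES NO SIDE on [IUTchIII] Cor. 3.12, on the claims of K. Joshi, or on S. Mochizuki's reports on them; typed ≠ proved;
typed AS A CANDIDATE ≠ endorsed. SOURCE (own reading of the cell's render `HOME/lit/renders/Joshi-arxiv-2401.13508/p0028.txt`;
«p.N l.M» = line M of page file N): K. Joshi, *Construction of Arithmetic Teichmüller Spaces III*, arXiv:2401.13508v4
(«Preliminary version for comments», UNREFEREED) = [J-III], §3.3, **Remark 3.3.1, p.28 l.13–21**:

> «Let `v|p` be any prime of `L` lying over some prime number `p` and let `L_v` be the completion of `L` at `v`. By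
> [Joshi, 2021a, Theorem 6.3.1], for every prime `p` and for every prime `v ∈ V_L` with `v|p`, every local holomorphoid
> of `X/L` at `v` has the field of definition `L_mod` (notably, the field of definition is independent of `p` and
> `v|p`). [Similarly for any `w|p` in `L'` one has the category `J(X/L'_w)^{C♭_p}` of [Joshi, 2021a, 2022] whose every
> object has `L_mod` as its field of definition.]»

WHAT IS TYPED. The remark is an APPLICATION of [J-I] Thm. 6.3.1 (2) (typed by abc-iut-E-t13 as the claim
`Joshi.ATSObj.Thm631Part2 IsSB X lmod DefinableOver J` over abc-iut-E-t1's carriers `Joshi.ATSObj X`, `X : TemperedCurve p`,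
file `Joshi/ATS1ConnectednessCohomology.lean` p430942 — imported BY NAME, nothing restated) place by place: a local
holomorphoid of `X/L` at `v` IS (by [J-III] Lemma 2.1.6, slot T-05/E-t58) an object of the local Arithmetic Teichmüller
space `J(X_{L_v}, L_v)` of [J-I] Def. 5.1.1. So the data the remark quantifies over is typed as ONE structure
`LocalHolomorphoidsAbove D p` (for Joshi's Initial Theta Data `D : ATS3.InitialThetaData L L' Lbar C ℓ` of
`Joshi/InitialThetaDataJoshi.lean`, abc-iut-E-t6 p428841, and a rational prime `p`): for each place `v` of a number field
`M ⊇ L` (`M = L` for the first sentence, `M = L'` for the bracketed one) in a chosen set `V` of places above `p`, the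
curve `X ×_L M_v` behind the tree's `TemperedCurve p` interface, the full subcategory `J v ⊆ 𝔍(X_v, M_v)` of local
holomorphoids at `v`, E-t13's abstract `IsSB` / `lmod` / `DefinableOver`, and the element `Lmod` NAMING `L_mod = D.Lmod
= fieldOfModuli C` ([J-III] §3.1 (4)) in the type where fields of moduli live, with the dictionary HYPOTHESIS field
`lmod_X : lmod (X v) = Lmod` («`L_mod` is the field of moduli of `X/L`», read at `v`: the field of moduli of the
`p`-adic curve `X ×_L M_v` is that of `X/L` — for `X = C ∖ {O}` both are `ℚ(j_C)`). Then:

* `Rmk331 ℱ : Prop` — the remark AS PRINTED (claim, `@[claim "Joshi2024ATS3" "disputed"]`, never asserted): every local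
  holomorphoid `A ∈ J v` at every `v ∈ V` is definable over `L_mod` and has field of moduli `L_mod`;
* `rmk331_of_thm631` — PROVED: if `X_v` is of strict Belyi type at every `v` ([J-III] §2.4 / Thm. 2.4.1 (1), the clause
  E-t6's structure flags as NOT CARRIED) and [J-I] Thm. 6.3.1 (2) holds at every `v` (E-t13's `Thm631Part2`), then
  `Rmk331 ℱ`; «independent of `p` and `v|p`» is the fact that ONE element `Lmod` serves every `v` (and every `p`, the
  structure being instantiated at each `p` with the same `D.Lmod`);
* `rmk331_isSB_of_thm631Part1` — the companion clause from Thm. 6.3.1 (1) (E-t13's `Thm631Part1`): every local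
  holomorphoid at `v` is again of strict Belyi type. PROVED (one line).

No definition of OUR frozen Cor. 3.12 interface is touched (R14: no Cor312*/Thm311* import); no new `Prop` FACT (the two
claim-Props are named, never asserted); no instance, no notation, no `sorry`. [claim: Joshi2024ATS3, status: disputed]
[claim: Joshi2021ATS1, status: disputed]
-/

noncomputable section

namespace Summit.ABC.IUTFork.Joshi.ATS3

open Literature.AnabelianGeometry.SemiGraphs (TemperedCurve)
open NumberField

universe u v w

variable {L : Type u} {L' : Type v} {Lbar : Type w} [Field L] [NumberField L] [Field L'] [NumberField L']
  [Algebra L L'] [Field Lbar] [Algebra L Lbar] [Algebra L' Lbar] {C : WeierstrassCurve L} [C.IsElliptic] {ℓ : ℕ}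

/-- **The data [J-III] Rmk. 3.3.1 (p.28 l.13–21) quantifies over**, for Joshi's Initial Theta Data `D` and a rational
prime `p`: a number field `M ⊇ L` (`M = L`: «any prime `v|p` of `L`»; `M = L'`: the bracketed sentence «for any `w|p` in
`L'`»), a set `V` of finite places of `M` above `p`, and for each `v ∈ V` the `p`-adic curve `X ×_L M_v` behind the
tree's `TemperedCurve p` interface together with the full subcategory `J v` of [J-I]'s local Arithmetic Teichmüller space
`𝔍(X_v, M_v)` (abc-iut-E-t1's `Joshi.ATSObj`) formed by the local holomorphoids of `X/L` at `v` ([J-III] Lemma 2.1.6,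
p.22); the predicates of [J-I] Thm. 6.3.1 in abc-iut-E-t13's abstract form (`IsSB` «strict Belyi type», `lmod` field of
moduli, `DefinableOver`); and the element `Lmod` naming `L_mod = D.Lmod = fieldOfModuli C` ([J-III] §3.1 (4), p.27
l.17) in the type `F` of number fields where `lmod` takes values. The field `lmod_X` is the DICTIONARY HYPOTHESIS «`L_mod`
= the field of moduli of `X`» read at each `v`. A signature; nothing is asserted. [claim: Joshi2024ATS3, status: disputed] -/
structure LocalHolomorphoidsAbove (D : InitialThetaData L L' Lbar C ℓ) (p : ℕ) [Fact p.Prime] where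
  /-- the number field whose places index the family (`L` itself, or `L'` for the bracketed sentence) -/
  M : Type
  [field : Field M]
  [numberField : NumberField M]
  [algebra : Algebra L M]
  /-- the primes `v | p` of `M` considered (print: «every prime `v ∈ V_L` with `v|p`») -/
  V : Set (FinitePlace M)
  /-- `X ×_L M_v` as a tempered curve over the `p`-adic field `M_v`, for each `v ∈ V` -/
  X : V → TemperedCurve p
  /-- the local holomorphoids of `X/L` at `v`, as a full subcategory of `𝔍(X_v, M_v)` ([J-III] Lemma 2.1.6) -/
  J : ∀ v : V, Set (ATSObj (X v))
  /-- «hyperbolic curve of strict Belyi type» ([J-I] Thm. 6.3.1's hypothesis; E-t13's abstract predicate) -/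
  IsSB : TemperedCurve p → Prop
  /-- the type of number fields in which fields of moduli / definition are compared -/
  F : Type
  /-- the field of moduli of a `p`-adic curve ([J-I] Thm. 6.3.1 (2)'s `L_mod`, E-t13's abstract map) -/
  lmod : TemperedCurve p → F
  /-- «`Y/E'` is definable over the number field `·`» ([J-I] Thm. 6.3.1 (2); E-t13's abstract predicate) -/
  DefinableOver : TemperedCurve p → F → Prop
  /-- the element naming `L_mod = D.Lmod = fieldOfModuli C` ([J-III] §3.1 (4)) in `F` -/
  Lmod : F
  /-- DICTIONARY HYPOTHESIS: the field of moduli of `X ×_L M_v` is `L_mod`, at every `v ∈ V` -/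
  lmod_X : ∀ v : V, lmod (X v) = Lmod

namespace LocalHolomorphoidsAbove

variable {D : InitialThetaData L L' Lbar C ℓ} {p : ℕ} [Fact p.Prime] (ℱ : LocalHolomorphoidsAbove D p)

/-- **[J-III] Remark 3.3.1, p.28 l.13–21, AS PRINTED** (for the family `ℱ` above `p`): «for every prime `v ∈ V_L` with
`v|p`, every local holomorphoid of `X/L` at `v` has the field of definition `L_mod`» — every `A = (Y/E', E' ↪ K, α)` in
`J v` is definable over `L_mod` and its field of moduli is `L_mod` (the two clauses of [J-I] Thm. 6.3.1 (2) with `L_mod`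
in place of `lmod X_v`). Never asserted. [claim: Joshi2024ATS3, status: disputed] -/
@[claim "Joshi2024ATS3" "disputed"]
def Rmk331 : Prop :=
  ∀ (v : ℱ.V) (A : ATSObj (ℱ.X v)), A ∈ ℱ.J v → ℱ.DefinableOver A.Y ℱ.Lmod ∧ ℱ.lmod A.Y = ℱ.Lmod

/-- **[J-I] Thm. 6.3.1 (2) ⟹ [J-III] Rmk. 3.3.1** («By [Joshi, 2021a, Theorem 6.3.1] …», p.28 l.14), PROVED over the typed
forms: if every `X_v` is of strict Belyi type ([J-III] §2.4 / Thm. 2.4.1 (1) — the clause E-t6's `InitialThetaData` does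
NOT carry, hence an explicit hypothesis here) and E-t13's `ATSObj.Thm631Part2` holds for `(X_v, J v)` at every `v ∈ V`,
then `Rmk331 ℱ`; the dictionary field `lmod_X` turns `lmod X_v` into the single element `Lmod` («independent of `p` and
`v|p`»). [claim: Joshi2024ATS3, status: disputed] [claim: Joshi2021ATS1, status: disputed] -/
theorem rmk331_of_thm631 (hSB : ∀ v : ℱ.V, ℱ.IsSB (ℱ.X v))
    (h631 : ∀ v : ℱ.V, ATSObj.Thm631Part2 (IsSB := ℱ.IsSB) (X := ℱ.X v) ℱ.lmod ℱ.DefinableOver (ℱ.J v)) :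
    ℱ.Rmk331 := by
  intro v A hA
  obtain ⟨hdef, hl⟩ := h631 v (hSB v) A hA
  exact ⟨ℱ.lmod_X v ▸ hdef, hl.trans (ℱ.lmod_X v)⟩

/-- The companion clause from [J-I] Thm. 6.3.1 (1) (E-t13's `ATSObj.Thm631Part1`): if every `X_v` is of strict Belyi type
and Thm. 6.3.1 (1) holds at every `v`, every local holomorphoid of `X/L` at `v` is of strict Belyi type. PROVED.
[claim: Joshi2021ATS1, status: disputed] -/
theorem isSB_of_thm631Part1 (hSB : ∀ v : ℱ.V, ℱ.IsSB (ℱ.X v))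
    (h631 : ∀ v : ℱ.V, ATSObj.Thm631Part1 (IsSB := ℱ.IsSB) (X := ℱ.X v) (ℱ.J v)) (v : ℱ.V) (A : ATSObj (ℱ.X v))
    (hA : A ∈ ℱ.J v) : ℱ.IsSB A.Y :=
  h631 v (hSB v) A hA

/-- Conversely the remark at `v` GIVES BACK Thm. 6.3.1 (2) for `(X_v, J v)` (the two statements differ only by the
dictionary `lmod X_v = L_mod`): the typing adds nothing to print. PROVED. [claim: Joshi2024ATS3, status: disputed] -/
theorem thm631Part2_of_rmk331 (h : ℱ.Rmk331) (v : ℱ.V) :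
    ATSObj.Thm631Part2 (IsSB := ℱ.IsSB) (X := ℱ.X v) ℱ.lmod ℱ.DefinableOver (ℱ.J v) := by
  intro _ A hA
  obtain ⟨hdef, hl⟩ := h v A hA
  exact ⟨(ℱ.lmod_X v).symm ▸ hdef, hl.trans (ℱ.lmod_X v).symm⟩

end LocalHolomorphoidsAbove

end Summit.ABC.IUTFork.Joshi.ATS3

end
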